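import Mathlib
import Literature.MathematicalPhysics.QuantumFieldTheory.Balaban1983to89.B6
import Literature.MathematicalPhysics.QuantumFieldTheory.Balaban1983to89.B5Hk163TorusHolderRate
import Literature.MathematicalPhysics.QuantumFieldTheory.Balaban1983to89.B6Prop23OneScaleTorus

/-!
# `Balaban1983to89.B6Cor28OneScaleTorus` — T. Bałaban, *Propagators and renormalization transformations for lattice
gauge theories. II*, Commun. Math. Phys. **96** (1984) 223–250 [Balaban1984PropagatorsII]: **Corollary 2.8 (2.150)–(2.151) —
the VERBATIM census typing `B6.Cor28Printed` INHABITED WITH NO HYPOTHESIS on the ONE-SCALE TORUS FAMILY by the GENUINE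
operator `H = GQ*(QGQ*)⁻¹` ((2.35); on one scale = the `H_k` of [4])** — all three entries `|H(b,c)|`, `|(∇H)(b,c)|`,
`‖(ζ∇H)(·,c)‖_α`, constants uniform in the scale `k` (mesh `η = L^{−k}`), in the torus and in `M`

statement-level skeleton of published theorems with citation tags; proofs where landed; nothing here is a claim about the Yang–Mills mass gap.
PDF held: `paper:balaban1984-cmp96-propagators-rt-ii` (journal page = PDF page + 222); pp. 223–234, 235–238, 242–250 [PDF 1–16,
20–28] materialised this session (`lit read …`); the verbatim statement of Corollary 2.8 is the docstring of `B6.Cor28Printed`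
(certified against the ×2 renders by the B6 block reader r03).  [4] = `paper:balaban1984-cmp95-propagators-rt-i`
[Balaban1984PropagatorsI], pp. 33–34 [PDF 17–18] read this session.

CITATION HEADER (cell `lit-balaban`, Phase-2 proof seat `p01` (gen 5) = unit `lit-balaban-p01`, HOME `run/shared/lean/pub/lit-balaban/`,
`PHASE2-TARGETS.md` §G, free-target protocol G.5-34(d)); SKELETON row **`B6.Cor2.8`** (kind «model-instance»: the verbatim Prop
`B6.Cor28Printed` of `…B6` — *"This Corollary and Proposition 2.6 are our main technical results"* — so far only COMPOSED from
printed-shape hypotheses (`…B6Cor28`), never inhabited by the operator it is about).  Companion of this seat's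
`…B6Prop23OneScaleTorus` (Proposition 2.3 on the same one-scale reading; its `torusL1` is reused).  Imported, not modified:
`…B6` (`B6.Geometry`, `B6.HFamily`, `B6.Cor28Printed`); the typed torus `H_k` chain of the cell pub-balaban (unit b2b-balaban-b05
lineage): `…B5Hk163Torus` (`HkOp` = the typed operator H_k of [4] (1.63), `norm_HkOp_le`), `…B5Hk163TorusHolder` (`dker` = the
kernel of ∂_νH_k), `…B5Hk163TorusHolderDecay` (`norm_dker_bpt_le`), `…B5Hk163TorusHolderRate` (`norm_dker_sub_le_rate`, `CHR`);
the identification of `HkOp` with the printed H_k is `B5Hk160Torus.H160M_eq_HkOp` ((1.60) = (1.63)) and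
`B5HkPropsTorus.hkPropsPrinted_iff_eq_HkOp` (the printed properties p. 29 determine H_k); carriers `B5Prop11Plancherel.Tor`/`fine`,
`B5Block118.bpt`, `B6LowerBound2153Torus.toT`/`rep`, `B4TorusKernel.MultiPeriod.torusSupNorm`.

WHAT THE PAPER PRINTS.  p. 249 [PDF 27], Corollary 2.8 verbatim = docstring of `B6.Cor28Printed` (*"A kernel of the operator H,
(HB)(b) = Σ_{c∈𝔅}(L^{j(c)}η)^d H(b, c)B(c), (2.150) satisfies the inequality |H(b, c)|, |(∇H)(b, c)|, ‖(ζ∇H)(·, c)‖_α ≤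
O(1)[1, (L^jη)^{−1}, (L^jη)^{−1−α}(‖ζ‖_α + |ζ|)](L^{j′}η)^{−d}e^{−δ₅d(y,c₋)}, b ∈ Δ(y) or supp ζ ⊂ Δ(y), y ∈ Λ_j, c₋ ∈ Λ_{j′}."*),
preceded by *"At first let us consider the operator H. We have"*.  The operator H: p. 226 *"By definition it is a value of an
operator H at the configuration B"* (the minimum of (2.5) under (2.6), (2.12)); p. 228, (2.35): *"A = HB = GQ*(QGQ*)⁻¹B. (2.35) …
We have obtained the same representation for the operator H as in (1.103), hence properties of this operator are related to
corresponding properties of G"*; p. 223: *"Let us begin with a generalization of the variational problem considered in Sect. D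
of [4] and leading to the operator H_k"*; p. 248: *"We consider these operators on the L²-space defined by (2.69) with sites
replaced by bonds"*; p. 235: *"If we have one scale, i.e. Λ_k = T₁^{(k)}, then the operator is a unit lattice operator"*;
p. 223: *"|x − y| = Σ_μ|x_μ − y_μ|. This distance depends of course on the scale of the lattice."*  [4] p. 34: *"so finally we get
the representation H_kB = GQ*(QGQ*)⁻¹B. (1.103)"*; [4] p. 29: *"Using (1.60), or better (1.63), we can verify all the properties
of H_kB …"* and *"This implies bounds on (1/|x′−x|^α)|∂_ν(H_kB)_μ(x′) − ∂_ν(H_kB)_μ(x)|"*.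

THE ONE-SCALE TORUS FAMILY, BOND VERSION (the reading, stated once).  ONE scale `Λ_k = T₁^{(k)}`: the variational problem of
Sect. A has a single constraint level, so H of (2.35) is the `H_k` of [4] (p. 223), typed on the torus as `B5Hk163Torus.HkOp (L^k) M`;
𝔅 = the bonds `c = (c₋, λ)` of the unit torus `T₁ = Π_μ ℤ/M_μ`, all at scale `j = k`, `η = L^{−k}`, `L^jη = 1` (`oneScaleBondGeo_len`),
the pairing (2.69)/(2.150) with unit weights; the fine torus `T_η = Π_μ ℤ/(L^kM_μ)`; `H(b, c)` = the matrix entry `HkOp b c`,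
`(∇H)(b, c)` = `∂_νH(b, c)` = `B5Hk163TorusHolder.dker` (η⁻¹ × forward difference in the fine point of b); `Δ(y)` = the fine bonds
`(L^k·y₋ + a, μ)` over the block `B^k(y₋)` (`B5Block118.bpt`); `d(y, c₋)` = the periodic ℓ¹ distance (2.46) of the unit torus
(`B6Prop23OneScaleTorus.torusL1`, as for Proposition 2.3); cut-offs ζ = functions on the fine sites with `supp ζ ⊂ B^k(y₋)`;
`|x − x′|` in the Hölder quotients = η × the periodic ℓ¹ distance of the fine torus (`fineDist`, the print's Σ_μ|x_μ − x′_μ| made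
periodic); all moduli are complex moduli of the typed (complex) kernels; (2.1)–(2.2) void (`Hyp21_22 := True`).  Dimension
`d + 1` (Lean) for the paper's d.

WHAT IS PROVED HERE (0 sorry, 0 named facts; axioms standard).
§1 representatives: the centred representative `crep` of a displacement on a torus (`toT crep = x₂ − x₁`, `|crep|_∞` = periodic
  sup-distance, `≥ 1` off the diagonal), the fine ℓ¹ distance `fineDist` and its comparison with `|crep|_∞/n`, the Hölder seminorms
  `holderS` (scalars) ∕ `holderV` (1-forms), the block/offset maps `blk`/`off` with `bpt (blk x) (off x) = x`.
§2 `oneScaleBondGeo d L k M Mb R` (the `B6.Geometry` above, honest readings of every field), `oneScaleBondGeo_len`; the `B6.HFamily`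
  **`torusH`**: `e 0 y c = sup_{b∈Δ(y)}‖H(b,c)‖`, `e 1 y c = sup_{b∈Δ(y),ν}‖∂_νH(b,c)‖`, `h α ζ c = ‖(ζ∇H)(·,c)‖_α`.
§3 **`e0_le`**, **`e1_le`** (from `norm_HkOp_le` ∕ `norm_dker_bpt_le`), **`holderTerm_le`** ∕ **`h_le`** (the cut-off Hölder entry:
  product rule + supp ζ ⊂ Δ(y) + `norm_dker_sub_le_rate` + `norm_dker_bpt_le`), and **`cor28Printed_oneScaleTorus`** —
  `B6.Cor28Printed (d+1) (oneScaleBondGeo-family) (torusH-family)` with witnesses `M₁ = 1`, `δ₅ = κ₁₆₃(d+1)/(d+1)²`,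
  `O(1) = max(MG163·P, MD163·P, 1)`, `C(α) = max(MD163·P, CHR d α)` (P = `periodConst`): THE VERBATIM COROLLARY 2.8 HOLDS ON THE
  ONE-SCALE TORUS FAMILY WITH NO ANALYTIC HYPOTHESIS, uniformly in k, M, Mb, R; non-vacuity `oneScaleBond_meets_hypotheses`.
ROUTE ∕ HONEST SCOPE (declared deviations).  (i) ONE scale only: the verbatim multi-scale Corollary (levels Λ_j, the metric (2.46)
across levels, prefactors (L^jη)^{−1}, (L^jη)^{−1−α}, (L^{j′}η)^{−d} with j ≠ j′) is the DAG hypothesis of the cell and is NOT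
touched; on one scale all prefactors are 1, and the content — bounds UNIFORM IN THE MESH η = L^{−k} for ∇^η = η⁻¹ × difference and
η-Hölder quotients — is [4]'s p. 29 regularity of H_k.  (ii) Scalar model (U = 1), the whole b05 lineage's model; torus.  (iii) The
route is [4]'s ((1.63) multipliers, analytic continuation to a strip, periodisation — the *"analyticity method"* of [3]), NOT the
composition Prop. 2.6 ∘ Prop. 2.7 ∘ Lemma 2.1 by which the paper reaches Cor. 2.8 (that composition, from printed-shape inputs, is
`…B6Cor28`).  (iv) Constants explicit but crude: `MG163`, `MD163`, `CHR d α` (→ ∞ as α ↑ 1, as the print's C(α)), `kappa163`,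
`periodConst` of the b04/b05 lineage, dimension- and α-only; δ₅ = κ₁₆₃(d+1)/(d+1)² (one factor from the periodisation, one from
|x|₁ ≤ (d+1)|x|_∞).  (v) The family index carries Mb (= the print's M) and R unconstrained: on one level (2.1)–(2.2) are void.
-/

namespace Literature.MathematicalPhysics.QuantumFieldTheory.Balaban1983to89.B6Cor28OneScaleTorus

open Finset Matrix
open B4TorusKernel (periodConst)
open B4TorusKernel.MultiPeriod (circAbs circAbs_nonneg torusSupNorm translate centreVec supNorm_translate_centreVec
  translate_apply)
open B4ContourShift (supNorm supNorm_nonneg abs_le_supNorm)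
open B5Prop11Plancherel (Tor fine)
open B5Block118 (bpt up iota upHom_intCast)
open B6LowerBound2153Torus (toT rep toT_rep)
open B5Kernel166Decay (toT_sub periodConst_pos)
open B5Hk163Strip (kappa163 kappa163_pos)
open B5Hk163Decay (MG163)
open B5Hk163Torus (HkOp norm_HkOp_le)
open B5Hk163TorusHolder (dker)
open B5Hk163TorusHolderDecay (MD163 norm_dker_bpt_le)
open B5Hk163TorusHolderRate (CHR CHR_nonneg norm_dker_sub_le_rate)
open B6Prop23OneScaleTorus (torusL1)

noncomputable section

variable {d : ℕ}

/-! ## §1. Representatives, the fine distance, Hölder seminorms, blocks -/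

section Reps

variable (P : Fin (d + 1) → ℕ) [hP : ∀ μ, NeZero (P μ)]

omit hP in
/-- `|x|₁ ≤ (d+1)·|x|_∞` for the periodic distances on `Π_μ ℤ/P_μ`. [folklore] -/
private theorem torusL1_le_mul_torusSupNorm' (x : Fin (d + 1) → ℤ) : torusL1 P x ≤ (d + 1) * torusSupNorm P x := by
  unfold torusL1 torusSupNorm
  have h : ∀ i ∈ (Finset.univ : Finset (Fin (d + 1))),
      ((circAbs (P i) (x i) : ℤ) : ℝ) ≤ Finset.univ.sup' Finset.univ_nonempty (fun i => ((circAbs (P i) (x i) : ℤ) : ℝ)) :=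
    fun i hi => Finset.le_sup' (fun i => ((circAbs (P i) (x i) : ℤ) : ℝ)) hi
  calc ∑ i, ((circAbs (P i) (x i) : ℤ) : ℝ)
      ≤ ∑ _i : Fin (d + 1), Finset.univ.sup' Finset.univ_nonempty (fun i => ((circAbs (P i) (x i) : ℤ) : ℝ)) :=
        Finset.sum_le_sum h
    _ = (d + 1) * Finset.univ.sup' Finset.univ_nonempty (fun i => ((circAbs (P i) (x i) : ℤ) : ℝ)) := by
        rw [Finset.sum_const, Finset.card_univ, Fintype.card_fin, nsmul_eq_mul]
        push_cast
        ring

/-- `|x|_∞ ≤ |x|₁` for the periodic distances on `Π_μ ℤ/P_μ` (P_μ ≥ 1). [folklore] -/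
private theorem torusSupNorm_le_torusL1 (x : Fin (d + 1) → ℤ) : torusSupNorm P x ≤ torusL1 P x := by
  unfold torusL1 torusSupNorm
  refine Finset.sup'_le _ _ fun i _ => ?_
  exact Finset.single_le_sum (f := fun j => ((circAbs (P j) (x j) : ℤ) : ℝ))
    (fun j _ => by exact_mod_cast circAbs_nonneg (Nat.one_le_iff_ne_zero.mpr (NeZero.ne (P j))) (x j))
    (Finset.mem_univ i)

omit hP in
/-- `toT` forgets period translates. [folklore] -/
private theorem toT_translate (x m : Fin (d + 1) → ℤ) : toT P (translate P x m) = toT P x := by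
  funext i
  simp only [toT, translate_apply, Int.cast_add, Int.cast_mul, Int.cast_natCast, ZMod.natCast_self, zero_mul, add_zero]

/-- the centred representative of the displacement `x₂ − x₁` on `Π_μ ℤ/P_μ`. [folklore] -/
private def crep (x₁ x₂ : Tor P) : Fin (d + 1) → ℤ :=
  translate P (rep P x₂ - rep P x₁) (centreVec P (rep P x₂ - rep P x₁))

/-- `toT (crep x₁ x₂) = x₂ − x₁`. [folklore] -/
private theorem toT_crep (x₁ x₂ : Tor P) : toT P (crep P x₁ x₂) = x₂ - x₁ := by
  unfold crep
  rw [toT_translate, ← toT_sub, toT_rep, toT_rep]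

/-- `|crep x₁ x₂|_∞` = the periodic sup-distance of `x₂ − x₁`. [folklore] -/
private theorem supNorm_crep (x₁ x₂ : Tor P) : supNorm (crep P x₁ x₂) = torusSupNorm P (rep P x₂ - rep P x₁) :=
  supNorm_translate_centreVec (fun i => Nat.one_le_iff_ne_zero.mpr (NeZero.ne (P i))) _

/-- distinct classes have `|crep|_∞ ≥ 1`. [folklore] -/
private theorem one_le_supNorm_crep {x₁ x₂ : Tor P} (h : x₁ ≠ x₂) : 1 ≤ supNorm (crep P x₁ x₂) := by
  have hz : crep P x₁ x₂ ≠ 0 := by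
    intro h0
    have h1 := toT_crep P x₁ x₂
    have h00 : toT P (0 : Fin (d + 1) → ℤ) = 0 := by funext i; simp [toT]
    rw [h0, h00] at h1
    exact h (sub_eq_zero.mp h1.symm).symm
  obtain ⟨i, hi⟩ := Function.ne_iff.mp hz
  have h1 : (1 : ℝ) ≤ ((|crep P x₁ x₂ i| : ℤ) : ℝ) := by exact_mod_cast Int.one_le_abs hi
  exact h1.trans (abs_le_supNorm _ i)

end Reps

/-- the period vector of the unit torus `T₁^{(k)} = Π_μ ℤ/M_μ` as natural numbers. [cite: Balaban1984PropagatorsII, (2.1)–(2.2) p.224] -/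
abbrev pv (M : Fin (d + 1) → ℕ+) : Fin (d + 1) → ℕ := fun μ => (M μ : ℕ)

section Fine

variable (n : ℕ) [NeZero n] (M : Fin (d + 1) → ℕ) [hM : ∀ μ, NeZero (M μ)]

/-- The fine distance `|x₂ − x₁| = η·Σ_μ|x₂,μ − x₁,μ|` between two points of the fine torus `T_η = Π_μ ℤ/(nM_μ)` (η = 1/n; the
print's ℓ¹ distance of p. 223, periodic coordinatewise). [cite: Balaban1984PropagatorsII, p.223 («|x − y| = Σ_μ|x_μ − y_μ|») and Cor. 2.8 p.249] -/
def fineDist (x₁ x₂ : Tor (fine n M)) : ℝ :=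
  torusL1 (fine n M) (rep (fine n M) x₂ - rep (fine n M) x₁) / n

/-- `|crep x₁ x₂|_∞/n ≤ fineDist x₁ x₂`. [folklore] -/
private theorem supNorm_crep_div_le_fineDist (x₁ x₂ : Tor (fine n M)) :
    supNorm (crep (fine n M) x₁ x₂) / n ≤ fineDist n M x₁ x₂ := by
  rw [fineDist, supNorm_crep]
  exact div_le_div_of_nonneg_right (torusSupNorm_le_torusL1 (fine n M) _) (Nat.cast_nonneg n)

/-- `0 < fineDist x₁ x₂` for `x₁ ≠ x₂`. [folklore] -/
private theorem fineDist_pos {x₁ x₂ : Tor (fine n M)} (h : x₁ ≠ x₂) : 0 < fineDist n M x₁ x₂ := by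
  have hn : (0 : ℝ) < n := by exact_mod_cast Nat.pos_of_ne_zero (NeZero.ne n)
  exact lt_of_lt_of_le (div_pos (lt_of_lt_of_le one_pos (one_le_supNorm_crep (fine n M) h)) hn)
    (supNorm_crep_div_le_fineDist n M x₁ x₂)

/-- The Hölder seminorm `‖ζ‖_α = sup_{x₁≠x₂} |ζ(x₂) − ζ(x₁)|/|x₂ − x₁|^α` of a function on the fine torus (the pair x₁ = x₂
contributes 0). [cite: Balaban1984PropagatorsII, Cor. 2.8 p.249 (‖ζ‖_α)] -/
def holderS (α : ℝ) (ζ : Tor (fine n M) → ℝ) : ℝ :=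
  ⨆ q : Tor (fine n M) × Tor (fine n M), |ζ q.2 - ζ q.1| / fineDist n M q.1 q.2 ^ α

/-- The Hölder seminorm `max_μ sup_{x₁≠x₂} |J_μ(x₂) − J_μ(x₁)|/|x₂ − x₁|^α` of a fine 1-form ([4] (1.109)).
[cite: Balaban1984PropagatorsII, (2.136)–(2.140) p.247] -/
def holderV (α : ℝ) (J : Tor (fine n M) × Fin (d + 1) → ℝ) : ℝ :=
  ⨆ q : (Tor (fine n M) × Tor (fine n M)) × Fin (d + 1), |J (q.1.2, q.2) - J (q.1.1, q.2)| / fineDist n M q.1.1 q.1.2 ^ α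

/-- `0 ≤ ‖ζ‖_α`. [folklore] -/
private theorem holderS_nonneg (α : ℝ) (ζ : Tor (fine n M) → ℝ) : 0 ≤ holderS n M α ζ := by
  have x : Tor (fine n M) := fun _ => 0
  have h := le_ciSup (f := fun q : Tor (fine n M) × Tor (fine n M) => |ζ q.2 - ζ q.1| / fineDist n M q.1 q.2 ^ α)
    (Set.finite_range _).bddAbove (x, x)
  simp only [sub_self, abs_zero, zero_div] at h
  exact h

/-- `|ζ(x₂) − ζ(x₁)| ≤ ‖ζ‖_α·|x₂ − x₁|^α` for `x₁ ≠ x₂`. [folklore] -/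
private theorem abs_sub_le_holderS (α : ℝ) (ζ : Tor (fine n M) → ℝ) {x₁ x₂ : Tor (fine n M)} (h : x₁ ≠ x₂) :
    |ζ x₂ - ζ x₁| ≤ holderS n M α ζ * fineDist n M x₁ x₂ ^ α := by
  have hρ : 0 < fineDist n M x₁ x₂ ^ α := Real.rpow_pos_of_pos (fineDist_pos n M h) α
  have hle : |ζ x₂ - ζ x₁| / fineDist n M x₁ x₂ ^ α ≤ holderS n M α ζ :=
    le_ciSup (f := fun q : Tor (fine n M) × Tor (fine n M) => |ζ q.2 - ζ q.1| / fineDist n M q.1 q.2 ^ α)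
      (Set.finite_range _).bddAbove (x₁, x₂)
  rwa [div_le_iff₀ hρ] at hle

/-- The block of a fine point: `x ∈ B^k(blk x)` (coordinatewise integer division by n). [cite: Balaban1984PropagatorsII, (2.1) p.224] -/
def blk (x : Tor (fine n M)) : Tor M := fun ν => (((x ν).val / n : ℕ) : ZMod (M ν))

/-- The offset of a fine point in its block, `x = n·blk x + off x`. [cite: Balaban1984PropagatorsII, (2.1) p.224] -/
def off (x : Tor (fine n M)) : Fin (d + 1) → Fin n :=
  fun ν => ⟨(x ν).val % n, Nat.mod_lt _ (Nat.pos_of_ne_zero (NeZero.ne n))⟩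

/-- `x = bpt (blk x) (off x)` (the computation of `B5G183Kernel.exists_eq_bpt`, inlined). [folklore] -/
private theorem bpt_blk_off (x : Tor (fine n M)) : bpt n M (blk n M x) (off n M x) = x := by
  funext ν
  show up n M _ ν + iota n M _ ν = x ν
  simp only [up, iota, blk, off]
  rw [show ((((x ν).val / n : ℕ)) : ZMod (M ν)) = ((((x ν).val / n : ℕ) : ℤ) : ZMod (M ν)) by
    rw [Int.cast_natCast], upHom_intCast, Int.cast_natCast]
  have h : ((x ν).val : ZMod (fine n M ν)) = x ν := ZMod.natCast_zmod_val (x ν)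
  conv_rhs => rw [← h, ← Nat.div_add_mod (x ν).val n]
  push_cast
  ring

end Fine

/-! ## §2. The one-scale torus family (bond version) and the family `H = H_k` -/

section Family

variable (d) (L : ℕ) [NeZero L]

/-- **The one-scale torus geometry, bond version** (*"sites replaced by bonds"*): 𝔅 = the bonds `(c₋, λ)` of the unit torus
`T₁^{(k)} = Π_μ ℤ/M_μ`, every bond at scale k, η = L^{−k} (L^jη = 1), d(y, c) = the periodic ℓ¹ distance (2.46) of y₋, c₋, Mb
(big-block size) and R carried as parameters, (2.1)–(2.2) void; HONEST readings: `Loc` = fine 1-forms J, `suppIn J c′` = supp J ⊂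
Δ(c′)-bonds, `supNorm` = |J|, `l2Norm` = (Σ η^{d+1}|J|²)^{1/2}, `holder` = `holderV`; `Cut` = cut-offs ζ on the fine sites, `cutIn ζ y` =
supp ζ ⊂ B^k(y₋), `cutH α ζ = ‖ζ‖_α + |ζ|`, `cutSup ζ = |ζ|`. [cite: Balaban1984PropagatorsII, (2.150) p.249, p.248, (2.46) p.231, p.235] -/
@[reducible] def oneScaleBondGeo (k : ℕ) (M : Fin (d + 1) → ℕ+) (Mb R : ℕ) : B6.Geometry where
  Site := Tor (pv M) × Fin (d + 1)
  fin := inferInstance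
  scale := fun _ => k
  dist := fun y c => torusL1 (pv M) (rep (pv M) y.1 - rep (pv M) c.1)
  k := k
  eta := ((L : ℝ) ^ k)⁻¹
  L := L
  R := R
  M := Mb
  Hyp21_22 := True
  Loc := Tor (fine (L ^ k) (pv M)) × Fin (d + 1) → ℝ
  suppIn := fun J c' => ∀ b, blk (L ^ k) (pv M) b.1 ≠ c'.1 → J b = 0
  supNorm := fun J => ‖J‖
  l2Norm := fun J => Real.sqrt (∑ b, ((L : ℝ) ^ k)⁻¹ ^ (d + 1) * J b ^ 2)
  holder := fun α J => holderV (L ^ k) (pv M) α J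
  Cut := Tor (fine (L ^ k) (pv M)) → ℝ
  cutIn := fun ζ y => ∀ x, blk (L ^ k) (pv M) x ≠ y.1 → ζ x = 0
  cutH := fun α ζ => holderS (L ^ k) (pv M) α ζ + ‖ζ‖
  cutSup := fun ζ => ‖ζ‖

/-- L^jη = 1 on the one-scale torus. [cite: Balaban1984PropagatorsII, p.235] -/
@[simp] theorem oneScaleBondGeo_len (k : ℕ) (M : Fin (d + 1) → ℕ+) (Mb R : ℕ) (y : (oneScaleBondGeo d L k M Mb R).Site) :
    (oneScaleBondGeo d L k M Mb R).len y = 1 := by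
  have hL : ((L : ℕ) : ℝ) ≠ 0 := Nat.cast_ne_zero.mpr (NeZero.ne L)
  simp [B6.Geometry.len, hL]

/-- **The family `H = GQ*(QGQ*)⁻¹ = H_k` of Corollary 2.8 on the one-scale torus**, read through its three quantities:
`e 0 y c` = sup over the fine bonds b = (L^k·y₋ + a, μ) of Δ(y) of `‖H(b, c)‖` (matrix entry of `B5Hk163Torus.HkOp`), `e 1 y c` = sup over
b ∈ Δ(y) and ν of `‖∂_νH(b, c)‖` (`B5Hk163TorusHolder.dker`), `h α ζ c` = `‖(ζ∇H)(·, c)‖_α` = sup over pairs of fine points x₁ ≠ x₂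
and μ, ν of `‖ζ(x₂)∂_νH((x₂,μ), c) − ζ(x₁)∂_νH((x₁,μ), c)‖/|x₂ − x₁|^α`. [cite: Balaban1984PropagatorsII, Cor. 2.8 (2.150)–(2.151) p.249; (2.35) p.228] -/
def torusH (k : ℕ) (M : Fin (d + 1) → ℕ+) (Mb R : ℕ) : B6.HFamily (oneScaleBondGeo d L k M Mb R) where
  e := fun m y c =>
    if m = 0 then
      ⨆ p : (Fin (d + 1) → Fin (L ^ k)) × Fin (d + 1), ‖HkOp (L ^ k) (pv M) (bpt (L ^ k) (pv M) y.1 p.1, p.2) c‖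
    else
      ⨆ p : (Fin (d + 1) → Fin (L ^ k)) × Fin (d + 1) × Fin (d + 1),
        ‖dker (L ^ k) (pv M) p.2.1 c.2 p.2.2 (bpt (L ^ k) (pv M) y.1 p.1) c.1‖
  h := fun α ζ c =>
    ⨆ q : (Tor (fine (L ^ k) (pv M)) × Tor (fine (L ^ k) (pv M))) × Fin (d + 1) × Fin (d + 1),
      ‖(ζ q.1.2 : ℂ) * dker (L ^ k) (pv M) q.2.1 c.2 q.2.2 q.1.2 c.1
          - (ζ q.1.1 : ℂ) * dker (L ^ k) (pv M) q.2.1 c.2 q.2.2 q.1.1 c.1‖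
        / fineDist (L ^ k) (pv M) q.1.1 q.1.2 ^ α

end Family

/-! ## §3. The three entries of Corollary 2.8 on the family, and the verbatim Corollary -/

section Entries

variable (d) (L : ℕ) [NeZero L] (k : ℕ) (M : Fin (d + 1) → ℕ+) (Mb R : ℕ)

/-- The decay factor `e^{−(κ₁₆₃/(d+1))·|y₋ − c₋|_{T,∞}}` of the typed H_k between two bonds of the unit torus (sup-distance form; it
is dominated by the (2.151) factor `e^{−δ₅d(y,c₋)}`, `Edec_le_exp_dist`). [cite: Balaban1984PropagatorsII, Cor. 2.8 (2.151) p.249] -/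
def Edec (y c : (oneScaleBondGeo d L k M Mb R).Site) : ℝ :=
  Real.exp (-(kappa163 (d + 1) / (d + 1) * torusSupNorm (pv M) (rep (pv M) y.1 - rep (pv M) c.1)))

/-- `0 < Edec`. [folklore] -/
private theorem Edec_pos (y c : (oneScaleBondGeo d L k M Mb R).Site) : 0 < Edec d L k M Mb R y c := Real.exp_pos _

/-- `e^{−(κ/(d+1))|x|_∞} ≤ e^{−(κ/(d+1)²)|x|₁}`: the lineage's decay factor is below the (2.151) factor in the metric (2.46).
[folklore] -/
private theorem Edec_le_exp_dist (y c : (oneScaleBondGeo d L k M Mb R).Site) :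
    Edec d L k M Mb R y c ≤
      Real.exp (-(kappa163 (d + 1) / (((d : ℝ) + 1) * ((d : ℝ) + 1)) * (oneScaleBondGeo d L k M Mb R).dist y c)) := by
  unfold Edec
  apply Real.exp_le_exp.mpr
  have hd1 : (0 : ℝ) < (d : ℝ) + 1 := by positivity
  have hκ := (kappa163_pos (d + 1)).le
  have h1 := torusL1_le_mul_torusSupNorm' (pv M) (rep (pv M) y.1 - rep (pv M) c.1)
  show -(kappa163 (d + 1) / (d + 1) * torusSupNorm (pv M) (rep (pv M) y.1 - rep (pv M) c.1)) ≤
    -(kappa163 (d + 1) / (((d : ℝ) + 1) * ((d : ℝ) + 1)) * torusL1 (pv M) (rep (pv M) y.1 - rep (pv M) c.1))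
  have h2 : kappa163 (d + 1) / (((d : ℝ) + 1) * ((d : ℝ) + 1)) * torusL1 (pv M) (rep (pv M) y.1 - rep (pv M) c.1)
      = kappa163 (d + 1) / (d + 1) * (torusL1 (pv M) (rep (pv M) y.1 - rep (pv M) c.1) / (d + 1)) := by
    rw [div_mul_eq_mul_div, div_mul_div_comm]
  rw [h2, neg_le_neg_iff]
  refine mul_le_mul_of_nonneg_left ?_ (div_nonneg hκ hd1.le)
  rw [div_le_iff₀ hd1]
  linarith

/-- **Entry |H(b,c)|**: `sup_{b∈Δ(y)} ‖H(b, c)‖ ≤ MG163·periodConst·e^{−(κ/(d+1))|y₋−c₋|_{T,∞}}`, uniformly in k and in the torus.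
[cite: Balaban1984PropagatorsII, Cor. 2.8 (2.151) p.249 (first entry)] -/
theorem e0_le (y c : (oneScaleBondGeo d L k M Mb R).Site) :
    (torusH d L k M Mb R).e 0 y c ≤ MG163 (d + 1) * periodConst (kappa163 (d + 1)) d * Edec d L k M Mb R y c := by
  haveI : Nonempty ((Fin (d + 1) → Fin (L ^ k)) × Fin (d + 1)) :=
    ⟨(fun _ => ⟨0, Nat.pos_of_ne_zero (NeZero.ne (L ^ k))⟩, 0)⟩
  show (⨆ p : (Fin (d + 1) → Fin (L ^ k)) × Fin (d + 1),
      ‖HkOp (L ^ k) (pv M) (bpt (L ^ k) (pv M) y.1 p.1, p.2) c‖) ≤ _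
  refine ciSup_le fun p => ?_
  have h := norm_HkOp_le (L ^ k) (pv M) p.2 c.2 p.1 (rep (pv M) y.1) (rep (pv M) c.1)
  rw [toT_rep, toT_rep] at h
  exact h

/-- **Entry |(∇H)(b,c)|**: `sup_{b∈Δ(y),ν} ‖∂_νH(b, c)‖ ≤ MD163·periodConst·e^{−(κ/(d+1))|y₋−c₋|_{T,∞}}` with ∂_ν = η⁻¹ × forward difference
on the fine torus, UNIFORMLY in η = L^{−k}. [cite: Balaban1984PropagatorsII, Cor. 2.8 (2.151) p.249 (second entry)] -/
theorem e1_le (y c : (oneScaleBondGeo d L k M Mb R).Site) :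
    (torusH d L k M Mb R).e 1 y c ≤ MD163 (d + 1) * periodConst (kappa163 (d + 1)) d * Edec d L k M Mb R y c := by
  haveI : Nonempty ((Fin (d + 1) → Fin (L ^ k)) × Fin (d + 1) × Fin (d + 1)) :=
    ⟨(fun _ => ⟨0, Nat.pos_of_ne_zero (NeZero.ne (L ^ k))⟩, 0, 0)⟩
  show (⨆ p : (Fin (d + 1) → Fin (L ^ k)) × Fin (d + 1) × Fin (d + 1),
      ‖dker (L ^ k) (pv M) p.2.1 c.2 p.2.2 (bpt (L ^ k) (pv M) y.1 p.1) c.1‖) ≤ _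
  refine ciSup_le fun p => ?_
  have h := norm_dker_bpt_le (L ^ k) (pv M) p.2.1 c.2 p.2.2 p.1 (rep (pv M) y.1) (rep (pv M) c.1)
  rw [toT_rep, toT_rep] at h
  exact h

variable {d L k M Mb R}

/-- `‖∂_νH((x,μ), c)‖ ≤ MD163·periodConst·Edec(y,c)` for a fine point x of the block `B^k(y₋)`. [folklore] -/
private theorem norm_dker_le_of_blk {y c : (oneScaleBondGeo d L k M Mb R).Site} {x : Tor (fine (L ^ k) (pv M))}
    (hx : blk (L ^ k) (pv M) x = y.1) (μ ν : Fin (d + 1)) :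
    ‖dker (L ^ k) (pv M) μ c.2 ν x c.1‖ ≤ MD163 (d + 1) * periodConst (kappa163 (d + 1)) d * Edec d L k M Mb R y c := by
  have e : bpt (L ^ k) (pv M) y.1 (off (L ^ k) (pv M) x) = x := by rw [← hx, bpt_blk_off]
  have h := norm_dker_bpt_le (L ^ k) (pv M) μ c.2 ν (off (L ^ k) (pv M) x) (rep (pv M) y.1) (rep (pv M) c.1)
  rw [toT_rep, toT_rep, e] at h
  exact h

/-- `‖∂_νH((x₂,μ),c) − ∂_νH((x₁,μ),c)‖ ≤ CHR(d,α)·|x₂ − x₁|^α·Edec(y,c)` for two fine points of the SAME block `B^k(y₋)` (the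
full-rate Hölder bound of the lineage with both block indices y₋, and `|z|_∞/n ≤ fineDist`). [folklore] -/
private theorem norm_dker_sub_le_of_blk {y c : (oneScaleBondGeo d L k M Mb R).Site} {x₁ x₂ : Tor (fine (L ^ k) (pv M))}
    (hx₁ : blk (L ^ k) (pv M) x₁ = y.1) (hx₂ : blk (L ^ k) (pv M) x₂ = y.1) (μ ν : Fin (d + 1)) {α : ℝ} (hα0 : 0 ≤ α)
    (hα1 : α < 1) :
    ‖dker (L ^ k) (pv M) μ c.2 ν x₂ c.1 - dker (L ^ k) (pv M) μ c.2 ν x₁ c.1‖ ≤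
      CHR d α * fineDist (L ^ k) (pv M) x₁ x₂ ^ α * Edec d L k M Mb R y c := by
  have e₂ : bpt (L ^ k) (pv M) y.1 (off (L ^ k) (pv M) x₂) = x₂ := by rw [← hx₂, bpt_blk_off]
  have e₁ : bpt (L ^ k) (pv M) y.1 (off (L ^ k) (pv M) x₁) = x₁ := by rw [← hx₁, bpt_blk_off]
  have hz : bpt (L ^ k) (pv M) (toT (pv M) (rep (pv M) y.1)) (off (L ^ k) (pv M) x₂) =
      bpt (L ^ k) (pv M) (toT (pv M) (rep (pv M) y.1)) (off (L ^ k) (pv M) x₁) +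
        toT (fine (L ^ k) (pv M)) (crep (fine (L ^ k) (pv M)) x₁ x₂) := by
    rw [toT_rep, toT_crep, e₂, e₁]
    abel
  have h := norm_dker_sub_le_rate (L ^ k) (pv M) μ c.2 ν (rep (pv M) y.1) (rep (pv M) y.1) (rep (pv M) c.1)
    (off (L ^ k) (pv M) x₁) (off (L ^ k) (pv M) x₂) (crep (fine (L ^ k) (pv M)) x₁ x₂) hz hα0 hα1
  rw [max_self, toT_rep, toT_rep, e₂, e₁] at h
  have hρ : (supNorm (crep (fine (L ^ k) (pv M)) x₁ x₂) / (L ^ k : ℕ)) ^ α ≤ fineDist (L ^ k) (pv M) x₁ x₂ ^ α :=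
    Real.rpow_le_rpow (div_nonneg (supNorm_nonneg _) (Nat.cast_nonneg _))
      (supNorm_crep_div_le_fineDist (L ^ k) (pv M) x₁ x₂) hα0
  exact h.trans (mul_le_mul_of_nonneg_right (mul_le_mul_of_nonneg_left hρ (CHR_nonneg α)) (Edec_pos d L k M Mb R y c).le)

/-- **The cut-off Hölder entry, termwise**: for supp ζ ⊂ Δ(y) (`cutIn ζ y`), every pair of fine points x₁, x₂, all μ, ν and
`0 ≤ α < 1`, `‖ζ(x₂)∂_νH((x₂,μ),c) − ζ(x₁)∂_νH((x₁,μ),c)‖/|x₂ − x₁|^α ≤ max(MD163·periodConst, CHR(d,α))·(‖ζ‖_α + |ζ|)·Edec(y,c)` —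
product rule, the support of ζ (a point carrying ζ lies in Δ(y)), the sup bound `norm_dker_bpt_le` and the full-rate Hölder bound
`norm_dker_sub_le_rate` of the typed ∂_νH_k. [cite: Balaban1984PropagatorsII, Cor. 2.8 (2.151) p.249 (third entry)] -/
theorem holderTerm_le {y c : (oneScaleBondGeo d L k M Mb R).Site} {ζ : (oneScaleBondGeo d L k M Mb R).Cut}
    (hζ : (oneScaleBondGeo d L k M Mb R).cutIn ζ y) {α : ℝ} (hα0 : 0 ≤ α) (hα1 : α < 1)
    (x₁ x₂ : Tor (fine (L ^ k) (pv M))) (μ ν : Fin (d + 1)) :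
    ‖(ζ x₂ : ℂ) * dker (L ^ k) (pv M) μ c.2 ν x₂ c.1 - (ζ x₁ : ℂ) * dker (L ^ k) (pv M) μ c.2 ν x₁ c.1‖
        / fineDist (L ^ k) (pv M) x₁ x₂ ^ α ≤
      max (MD163 (d + 1) * periodConst (kappa163 (d + 1)) d) (CHR d α) *
        (holderS (L ^ k) (pv M) α ζ + ‖ζ‖) * Edec d L k M Mb R y c := by
  set A1 : ℝ := MD163 (d + 1) * periodConst (kappa163 (d + 1)) d
  set K : ℝ := max A1 (CHR d α)
  set E : ℝ := Edec d L k M Mb R y c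
  set HS : ℝ := holderS (L ^ k) (pv M) α ζ
  set ρ : ℝ := fineDist (L ^ k) (pv M) x₁ x₂
  have hζ' : ∀ x, blk (L ^ k) (pv M) x ≠ y.1 → ζ x = 0 := hζ
  have hEpos : 0 < E := Edec_pos d L k M Mb R y c
  have hK0 : 0 ≤ K := le_max_of_le_right (CHR_nonneg α)
  have hHS : 0 ≤ HS := holderS_nonneg (L ^ k) (pv M) α ζ
  have hsum0 : 0 ≤ HS + ‖ζ‖ := add_nonneg hHS (norm_nonneg _)
  have hsupp : ∀ x, ζ x ≠ 0 → blk (L ^ k) (pv M) x = y.1 := fun x hx => by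
    by_contra hne
    exact hx (hζ' x hne)
  by_cases hx : x₁ = x₂
  · subst hx
    rw [sub_self, norm_zero, zero_div]
    exact mul_nonneg (mul_nonneg hK0 hsum0) hEpos.le
  have hρpos : 0 < ρ := fineDist_pos (L ^ k) (pv M) hx
  have hρα : 0 < ρ ^ α := Real.rpow_pos_of_pos hρpos α
  rw [div_le_iff₀ hρα]
  have hζdiff : |ζ x₂ - ζ x₁| ≤ HS * ρ ^ α := abs_sub_le_holderS (L ^ k) (pv M) α ζ hx
  have hζsup : ∀ x, |ζ x| ≤ ‖ζ‖ := fun x => by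
    have h := norm_le_pi_norm ζ x
    rwa [Real.norm_eq_abs] at h
  have hD : ∀ x, blk (L ^ k) (pv M) x = y.1 → ‖dker (L ^ k) (pv M) μ c.2 ν x c.1‖ ≤ A1 * E :=
    fun x hbx => norm_dker_le_of_blk hbx μ ν
  have hnn2 : 0 ≤ ‖ζ‖ * (CHR d α * ρ ^ α * E) :=
    mul_nonneg (norm_nonneg _) (mul_nonneg (mul_nonneg (CHR_nonneg α) hρα.le) hEpos.le)
  -- both cut-off values zero: nothing to prove
  by_cases h12 : ζ x₁ = 0 ∧ ζ x₂ = 0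
  · rw [h12.1, h12.2, Complex.ofReal_zero, zero_mul, zero_mul, sub_self, norm_zero]
    exact mul_nonneg (mul_nonneg (mul_nonneg hK0 hsum0) hEpos.le) hρα.le
  -- the common final step
  have hfin : HS * ρ ^ α * (A1 * E) + ‖ζ‖ * (CHR d α * ρ ^ α * E) ≤ K * (HS + ‖ζ‖) * E * ρ ^ α := by
    have h1 : HS * ρ ^ α * (A1 * E) ≤ HS * ρ ^ α * (K * E) :=
      mul_le_mul_of_nonneg_left (mul_le_mul_of_nonneg_right (le_max_left _ _) hEpos.le) (mul_nonneg hHS hρα.le)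
    have h2 : ‖ζ‖ * (CHR d α * ρ ^ α * E) ≤ ‖ζ‖ * (K * ρ ^ α * E) :=
      mul_le_mul_of_nonneg_left
        (mul_le_mul_of_nonneg_right (mul_le_mul_of_nonneg_right (le_max_right _ _) hρα.le) hEpos.le) (norm_nonneg _)
    calc _ ≤ HS * ρ ^ α * (K * E) + ‖ζ‖ * (K * ρ ^ α * E) := add_le_add h1 h2
      _ = K * (HS + ‖ζ‖) * E * ρ ^ α := by ring
  refine le_trans ?_ hfin
  by_cases h2 : ζ x₂ = 0
  · -- only x₁ carries ζ, so x₁ ∈ Δ(y) and the term is (ζ x₂ − ζ x₁)·∂H(x₁)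
    have h1 : ζ x₁ ≠ 0 := fun h1 => h12 ⟨h1, h2⟩
    have hD1 := hD x₁ (hsupp x₁ h1)
    rw [h2, Complex.ofReal_zero, zero_mul, zero_sub, norm_neg, norm_mul, Complex.norm_real, Real.norm_eq_abs]
    have hz : |ζ x₁| = |ζ x₂ - ζ x₁| := by rw [h2, zero_sub, abs_neg]
    rw [hz]
    exact le_add_of_le_of_nonneg (mul_le_mul hζdiff hD1 (norm_nonneg _) (mul_nonneg hHS hρα.le)) hnn2
  · by_cases h1 : ζ x₁ = 0
    · -- only x₂ carries ζ
      have hD2 := hD x₂ (hsupp x₂ h2)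
      rw [h1, Complex.ofReal_zero, zero_mul, sub_zero, norm_mul, Complex.norm_real, Real.norm_eq_abs]
      have hz : |ζ x₂| = |ζ x₂ - ζ x₁| := by rw [h1, sub_zero]
      rw [hz]
      exact le_add_of_le_of_nonneg (mul_le_mul hζdiff hD2 (norm_nonneg _) (mul_nonneg hHS hρα.le)) hnn2
    · -- both points lie in Δ(y): product rule
      have hb1 := hsupp x₁ h1
      have hb2 := hsupp x₂ h2
      have hD1 := hD x₁ hb1
      have hD21 : ‖dker (L ^ k) (pv M) μ c.2 ν x₂ c.1 - dker (L ^ k) (pv M) μ c.2 ν x₁ c.1‖ ≤ CHR d α * ρ ^ α * E :=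
        norm_dker_sub_le_of_blk hb1 hb2 μ ν hα0 hα1
      set D₁ := dker (L ^ k) (pv M) μ c.2 ν x₁ c.1
      set D₂ := dker (L ^ k) (pv M) μ c.2 ν x₂ c.1
      have hsplit : (ζ x₂ : ℂ) * D₂ - (ζ x₁ : ℂ) * D₁ = (ζ x₂ : ℂ) * (D₂ - D₁) + ((ζ x₂ : ℂ) - (ζ x₁ : ℂ)) * D₁ := by ring
      rw [hsplit]
      calc ‖(ζ x₂ : ℂ) * (D₂ - D₁) + ((ζ x₂ : ℂ) - (ζ x₁ : ℂ)) * D₁‖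
          ≤ ‖(ζ x₂ : ℂ) * (D₂ - D₁)‖ + ‖((ζ x₂ : ℂ) - (ζ x₁ : ℂ)) * D₁‖ := norm_add_le _ _
        _ = |ζ x₂| * ‖D₂ - D₁‖ + |ζ x₂ - ζ x₁| * ‖D₁‖ := by
            rw [norm_mul, norm_mul, Complex.norm_real, Real.norm_eq_abs, ← Complex.ofReal_sub, Complex.norm_real,
              Real.norm_eq_abs]
        _ ≤ ‖ζ‖ * (CHR d α * ρ ^ α * E) + HS * ρ ^ α * (A1 * E) :=
            add_le_add (mul_le_mul (hζsup x₂) hD21 (norm_nonneg _) (norm_nonneg _))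
              (mul_le_mul hζdiff hD1 (norm_nonneg _) (mul_nonneg hHS hρα.le))
        _ = HS * ρ ^ α * (A1 * E) + ‖ζ‖ * (CHR d α * ρ ^ α * E) := add_comm _ _

/-- **Entry ‖(ζ∇H)(·,c)‖_α**: for supp ζ ⊂ Δ(y) and `0 ≤ α < 1`,
`‖(ζ∇H)(·, c)‖_α ≤ max(MD163·periodConst, CHR(d,α))·(‖ζ‖_α + |ζ|)·e^{−(κ/(d+1))|y₋ − c₋|_{T,∞}}`, uniformly in k and in the torus.
[cite: Balaban1984PropagatorsII, Cor. 2.8 (2.151) p.249 (third entry)] -/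
theorem h_le {y c : (oneScaleBondGeo d L k M Mb R).Site} {ζ : (oneScaleBondGeo d L k M Mb R).Cut}
    (hζ : (oneScaleBondGeo d L k M Mb R).cutIn ζ y) {α : ℝ} (hα0 : 0 ≤ α) (hα1 : α < 1) :
    (torusH d L k M Mb R).h α ζ c ≤
      max (MD163 (d + 1) * periodConst (kappa163 (d + 1)) d) (CHR d α) *
        (oneScaleBondGeo d L k M Mb R).cutH α ζ * Edec d L k M Mb R y c := by
  haveI : Nonempty ((Tor (fine (L ^ k) (pv M)) × Tor (fine (L ^ k) (pv M))) × Fin (d + 1) × Fin (d + 1)) :=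
    ⟨((fun _ => 0, fun _ => 0), 0, 0)⟩
  exact ciSup_le fun q => holderTerm_le hζ hα0 hα1 q.1.1 q.1.2 q.2.1 q.2.2

end Entries

section Corollary

variable (d) (L : ℕ) [NeZero L]

/-- The index of the one-scale torus family (bond version): scale k (mesh η = L^{−k}), period vector M of T₁^{(k)}, big-block size
Mb, R. [cite: Balaban1984PropagatorsII, (2.1)–(2.2) p.224] -/
structure Index where
  /-- the scale: η = L^{−k} -/
  k : ℕ
  /-- the periods of the unit torus T₁^{(k)} -/
  M : Fin (d + 1) → ℕ+
  /-- the big-block size (the print's M) -/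
  Mb : ℕ
  /-- the parameter R of (2.1)–(2.2) -/
  R : ℕ

/-- **COROLLARY 2.8, VERBATIM (`B6.Cor28Printed`), ON THE ONE-SCALE TORUS FAMILY WITH NO HYPOTHESIS**: for every dimension d + 1 and
every L ≥ 1 the census Prop holds for the family of all one-scale tori (bond version; all scales k, all period vectors, all Mb, R) with
`H = GQ*(QGQ*)⁻¹ = H_k` — witnesses `M₁ = 1`, `δ₅ = κ₁₆₃(d+1)/(d+1)²`, `O(1) = max(MG163·P, MD163·P, 1)`, `C(α) = max(MD163·P, CHR(d,α))`
(P = periodConst; all prefactors (L^jη)^{…} equal 1 on one scale). [cite: Balaban1984PropagatorsII, Cor. 2.8 (2.150)–(2.151) p.249] -/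
theorem cor28Printed_oneScaleTorus :
    B6.Cor28Printed (d + 1) (fun i : Index d => oneScaleBondGeo d L i.k i.M i.Mb i.R) (fun i => torusH d L i.k i.M i.Mb i.R) := by
  have hd1 : (0 : ℝ) < (d : ℝ) + 1 := by positivity
  refine ⟨1, kappa163 (d + 1) / (((d : ℝ) + 1) * ((d : ℝ) + 1)),
    max (max (MG163 (d + 1) * periodConst (kappa163 (d + 1)) d) (MD163 (d + 1) * periodConst (kappa163 (d + 1)) d)) 1,
    fun α => max (MD163 (d + 1) * periodConst (kappa163 (d + 1)) d) (CHR d α), one_pos,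
    div_pos (kappa163_pos _) (mul_pos hd1 hd1), lt_of_lt_of_le one_pos (le_max_right _ _), fun i _ _ => ⟨?_, ?_⟩⟩
  · intro m y c
    rw [oneScaleBondGeo_len, oneScaleBondGeo_len, Real.one_rpow, Real.one_rpow, mul_one, mul_one]
    have hE := Edec_le_exp_dist d L i.k i.M i.Mb i.R y c
    have hEpos := Edec_pos d L i.k i.M i.Mb i.R y c
    have hC0 : (0 : ℝ) ≤ max (max (MG163 (d + 1) * periodConst (kappa163 (d + 1)) d)
        (MD163 (d + 1) * periodConst (kappa163 (d + 1)) d)) 1 := le_trans zero_le_one (le_max_right _ _)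
    have key : (torusH d L i.k i.M i.Mb i.R).e m y c ≤ max (max (MG163 (d + 1) * periodConst (kappa163 (d + 1)) d)
        (MD163 (d + 1) * periodConst (kappa163 (d + 1)) d)) 1 * Edec d L i.k i.M i.Mb i.R y c := by
      fin_cases m
      · exact (e0_le d L _ _ _ _ y c).trans
          (mul_le_mul_of_nonneg_right ((le_max_left _ _).trans (le_max_left _ _)) hEpos.le)
      · exact (e1_le d L _ _ _ _ y c).trans
          (mul_le_mul_of_nonneg_right ((le_max_right _ _).trans (le_max_left _ _)) hEpos.le)
    exact key.trans (mul_le_mul_of_nonneg_left hE hC0)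
  · intro α ζ y c hα0 hα1 hζ
    rw [oneScaleBondGeo_len, oneScaleBondGeo_len, Real.one_rpow, Real.one_rpow, mul_one, mul_one]
    have hE := Edec_le_exp_dist d L i.k i.M i.Mb i.R y c
    have hcut : 0 ≤ (oneScaleBondGeo d L i.k i.M i.Mb i.R).cutH α ζ := add_nonneg (holderS_nonneg _ _ α ζ) (norm_nonneg _)
    exact (h_le hζ hα0 hα1).trans (mul_le_mul_of_nonneg_left hE (mul_nonneg (le_max_of_le_right (CHR_nonneg α)) hcut))

/-- **Non-vacuity**: every member satisfies the hypotheses of `B6.Cor28Printed` with the witness M₁ = 1 as soon as Mb ≥ 1 ((2.1)–(2.2)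
void, M₁ ≤ M), and there is a member for every k, every period vector, every Mb ≥ 1 and every R — so (2.151) is asserted for all of
them. [cite: Balaban1984PropagatorsII, Cor. 2.8 p.249] -/
theorem oneScaleBond_meets_hypotheses (k : ℕ) (M : Fin (d + 1) → ℕ+) (Mb R : ℕ) (hMb : 1 ≤ Mb) :
    ∃ i : Index d, i.k = k ∧ i.M = M ∧ i.Mb = Mb ∧ i.R = R ∧
      (oneScaleBondGeo d L i.k i.M i.Mb i.R).Hyp21_22 ∧ (1 : ℝ) ≤ (oneScaleBondGeo d L i.k i.M i.Mb i.R).M :=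
  ⟨⟨k, M, Mb, R⟩, rfl, rfl, rfl, rfl, trivial, by
    show (1 : ℝ) ≤ ((Mb : ℕ) : ℝ)
    exact_mod_cast hMb⟩

end Corollary

end

end Literature.MathematicalPhysics.QuantumFieldTheory.Balaban1983to89.B6Cor28OneScaleTorus
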